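import Summits.QuantumFields.YangMills.Theorems.FemtoTransferGapSpectralSums
import Summits.QuantumFields.YangMills.Theorems.FemtoTransferGapGroundState
import Summits.QuantumFields.YangMills.Theorems.FemtoTransferGapLevelsDecay
import Summits.QuantumFields.YangMills.Theorems.LuscherReductionRunningReductionKTPhysSpace
import HarnessLib

/-!
# Femto transfer gap — the SPECTRAL DOOR of the upward incommensurable step of crux `SubOctaveBounded` (stmt-QuantumFields-24085):
# block-time autocorrelation of ONE physical trial vector orthogonal to the vacuum bounds `λ₁^ℓ` from below, hence
# «vacuum-chain comparison ⟹ fine-below-coarse step»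

Seat `ym-line-fcl-p3` (2026-08-28).  Route-independent (imports no `Theses` file); fixed-lattice transfer-operator algebra over the tree's
complete physical eigenbasis (`SpecSum.exists_spectral_eigenseq`) and Jentzsch ground state (`PhysL2.exists_groundState_gap`).

* §1 `l2_eigen_top_eq_zero_of_l2_ground_eq_zero` — the top eigenvalue is SIMPLE (`secondValue < topValue`), so every physical unit top eigenvector
  `Ω` spans the same line as the eigenbasis vector `e₀`: a physical `v ⊥ Ω` is `⊥ e₀`.
* §2 ★ `l2_iterate_le_pow_secondValue` — for physical `v ⊥ Ω` and every block time `ℓ ≥ 1`: `⟨v, K_β^ℓ v⟩ ≤ λ₁^ℓ·‖v‖²`.  Read backwards this is the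
  VARIATIONAL LOWER BOUND `λ₁(β,L)^ℓ ≥ ⟨v,K^ℓv⟩/‖v‖²` from ONE trial vector; `iterate_transferApply_ground`: `K^ℓ Ω = λ₀^ℓ Ω`, so
  `λ₀^ℓ = ⟨Ω,K^ℓΩ⟩` exactly and the ratio `(λ₁/λ₀)^ℓ` is bounded below by a quotient of two vacuum-chain expectations.
* §3 ★★ `upStepEventually_of_dynComparison` — THE DOOR.  If deep in the femto window, for every incommensurable pair `L₀ ≤ L' < L < 2L'` at matched
  running parameter and every normalised physical exact ground state `Ω` of the FINE transfer operator, some physical `v ⊥ Ω` has physical-time-1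
  autocorrelation `⟨v,K_β^L v⟩/(λ₀^L‖v‖²) ≥ e^{−CΛ²}·(λ₁'/λ₀')^{L'}` (the coarse ratio), then the upward step «fine below coarse»
  `λ₁(β',L')^{L'}·λ₀(β,L)^L ≤ e^{CΛ²}·λ₁(β,L)^L·λ₀(β',L')^{L'}` holds (eventually form) — the hypothesis (hU) of
  `CutoffLadder.femtoGapOfRecord_of_towerLadder_up`, which with `OctaveStepDecay`, the fixed-lattice leaf, anchor and matching closes `FemtoGapOfRecord`.
  The intended `v`: the coarse first excitation pulled back along the thinning map (`FemtoCutoffLadderThinningDefs`: physical, `L²`-isometric) and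
  re-centred against `Ω`; what the hypothesis then asks is a comparison of TWO-TIME VACUUM EXPECTATIONS of one blocked observable between the
  cutoffs `L` and `L'` to relative precision `CΛ²` — the form in which two-cutoff (Bałaban-type) control is stated.  Nothing of that is proved here.

HONEST FRAMING: bookkeeping at fixed lattice; R2b1 is a RECORD rung; no step, no continuum statement and no summit is proved by this module.
No definitions, no named facts, no `sorry`.
-/

set_option autoImplicit false

noncomputable section

namespace Summit.QuantumFields.YangMills.Theorems.FemtoTransferGap.UpStep

open MeasureTheory
open Literature.MathematicalPhysics.QuantumFieldTheory
open Summit.QuantumFields.YangMills.Theorems.FemtoTransferGap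

variable {L : ℕ} [NeZero L]

/-! ## §1 Simplicity of the top eigenvalue: `v ⊥ Ω ⟹ v ⊥ e₀` -/

/-- `l2` against a scalar multiple on the right. [folklore] -/
theorem l2_smul_right' (a : ℝ) (ψ φ : GaugeConfig 3 L SU2 → ℝ) : l2 ψ (a • φ) = a * l2 ψ φ := by
  rw [l2_comm, l2_smul_left, l2_comm]

/-- **Simplicity of the vacuum, in trial-function currency.**  Let `e₀` and `Ω` be physical, `l2`-normalised, exact top eigenvectors of `K_β`
(with level-`1` domination off `e₀`).  Then every physical `v ⊥ Ω` is `⊥ e₀`.  Proof: `r = Ω − ⟨Ω,e₀⟩e₀ ⊥ e₀` is again a `λ₀`-eigenvector, so Courant–Fischer domination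
at level `1` (`hdom`) gives `λ₀‖r‖² ≤ λ₁‖r‖²`, whence `‖r‖² = 0` by `λ₁ < λ₀` (`secondValue_lt_topValue`); Cauchy–Schwarz kills `⟨v,r⟩`, and
`⟨Ω,e₀⟩² = 1 ≠ 0`. [cite: ReedSimonIV1978, Thm. XIII.44] -/
theorem l2_eigen_top_eq_zero_of_l2_ground_eq_zero {β : ℝ} {e₀ Ω v : GaugeConfig 3 L SU2 → ℝ}
    (he₀ : IsPhys e₀) (he₀1 : l2 e₀ e₀ = 1) (he₀eig : transferApply β e₀ = levelValue su2Rep L β 0 • e₀)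
    (hdom : ∀ ψ : GaugeConfig 3 L SU2 → ℝ, IsPhys ψ → l2 ψ e₀ = 0 → qform su2Rep β ψ ψ ≤ levelValue su2Rep L β 1 * l2 ψ ψ)
    (hΩ : IsPhys Ω) (hΩ1 : l2 Ω Ω = 1) (hΩeig : transferApply β Ω = topValue su2Rep L β • Ω)
    (hv : IsPhys v) (hvΩ : l2 v Ω = 0) : l2 v e₀ = 0 := by
  obtain ⟨c, hc⟩ : ∃ c : ℝ, l2 Ω e₀ = c := ⟨_, rfl⟩
  have hce : l2 e₀ Ω = c := by rw [l2_comm, hc]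
  rw [levelValue_zero] at he₀eig
  have hlv1 : levelValue su2Rep L β 1 < topValue su2Rep L β := by
    rw [levelValue_one]; exact PhysL2.secondValue_lt_topValue β
  -- the residual `r = Ω + (−c) • e₀`
  obtain ⟨r, hr⟩ : ∃ r : GaugeConfig 3 L SU2 → ℝ, r = Ω + (-c) • e₀ := ⟨_, rfl⟩
  have hre : IsPhys ((-c) • e₀) := he₀.smul (-c)
  have hrp : IsPhys r := by rw [hr]; exact hΩ.add hre
  -- `r ⊥ e₀`
  have hr0 : l2 r e₀ = 0 := by
    rw [hr, l2_add_left hΩ hre he₀, l2_smul_left, he₀1, hc]; ring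
  -- `‖r‖² = 1 − c²`
  have hΩr : l2 Ω r = 1 - c ^ 2 := by
    rw [hr, l2_comm, l2_add_left hΩ hre hΩ, l2_smul_left, hΩ1, hce]; ring
  have he₀r : l2 e₀ r = 0 := by rw [l2_comm, hr0]
  have hrr : l2 r r = 1 - c ^ 2 := by
    nth_rw 1 [hr]
    rw [l2_add_left hΩ hre hrp, l2_smul_left, hΩr, he₀r]; ring
  -- `⟨r, K r⟩ = λ₀ ‖r‖²` (`K` hits only the eigenvectors `Ω`, `e₀`)
  have hKr : transferApply β r = topValue su2Rep L β • r := by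
    rw [hr, transferApply_add β hΩ hre, transferApply_smul, hΩeig, he₀eig, smul_comm (-c) (topValue su2Rep L β) e₀, ← smul_add]
  have hqr : qform su2Rep β r r = topValue su2Rep L β * (1 - c ^ 2) := by
    rw [qform_eq_l2_transferApply, hKr, l2_smul_right', hrr]
  -- domination at level 1 and `λ₁ < λ₀` force `‖r‖² = 0`
  have hdomr := hdom r hrp hr0
  rw [hqr, hrr] at hdomr
  have hrr0 : 0 ≤ 1 - c ^ 2 := by rw [← hrr]; exact l2_self_nonneg r
  have hzero : 1 - c ^ 2 = 0 := by nlinarith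
  -- Cauchy–Schwarz: `⟨v, r⟩ = 0`
  have hcs := sq_l2_le hv hrp
  rw [hrr, hzero, mul_zero] at hcs
  have hvr : l2 v r = 0 := pow_eq_zero_iff two_ne_zero |>.mp (le_antisymm hcs (sq_nonneg _))
  -- unfold `⟨v, r⟩ = ⟨v,Ω⟩ − c⟨v,e₀⟩`
  have hvr' : l2 v r = l2 v Ω + (-c) * l2 v e₀ := by
    rw [hr, l2_comm, l2_add_left hΩ hre hv, l2_smul_left, l2_comm Ω v, l2_comm e₀ v]
  rw [hvr', hvΩ, zero_add] at hvr
  have hc0 : c ≠ 0 := by intro h0; rw [h0] at hzero; norm_num at hzero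
  rcases mul_eq_zero.mp hvr with h | h
  · exact absurd (neg_eq_zero.mp h) hc0
  · exact h

/-! ## §2 Block-time autocorrelation of a trial vector orthogonal to the vacuum is at most `λ₁^ℓ` -/

/-- **`K^ℓ Ω = λ₀^ℓ Ω`** for an exact top eigenvector. [folklore] -/
theorem iterate_transferApply_ground {β : ℝ} {Ω : GaugeConfig 3 L SU2 → ℝ} (hΩeig : transferApply β Ω = topValue su2Rep L β • Ω) (ℓ : ℕ) :
    (transferApply β)^[ℓ] Ω = topValue su2Rep L β ^ ℓ • Ω := by
  induction ℓ with
  | zero => simp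
  | succ ℓ ih => rw [Function.iterate_succ_apply', ih, transferApply_smul, hΩeig, smul_smul, pow_succ, mul_comm]

/-- Hence `⟨Ω, K^ℓ Ω⟩ = λ₀^ℓ` for a normalised exact top eigenvector. [folklore] -/
theorem l2_iterate_ground {β : ℝ} {Ω : GaugeConfig 3 L SU2 → ℝ} (hΩ1 : l2 Ω Ω = 1)
    (hΩeig : transferApply β Ω = topValue su2Rep L β • Ω) (ℓ : ℕ) :
    l2 Ω ((transferApply β)^[ℓ] Ω) = topValue su2Rep L β ^ ℓ := by
  rw [iterate_transferApply_ground hΩeig, l2_smul_right', hΩ1, mul_one]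

/-- ★ **Variational lower bound for `λ₁^ℓ` from one trial vector orthogonal to the vacuum** (equivalently: the block-time-`ℓ` autocorrelation of a
physical `v ⊥ Ω` is at most `λ₁^ℓ‖v‖²`): `⟨v, K_β^ℓ v⟩ ≤ secondValue^ℓ · ‖v‖²` for `β > 0`, `ℓ ≥ 1`, `Ω` any normalised physical exact top
eigenvector.  Spectral sum `⟨v,K^ℓv⟩ = Σ_k λ_k^ℓ⟨v,e_k⟩²` over the complete physical eigenbasis, `⟨v,e₀⟩ = 0` by §1, `λ_k ≤ λ₁` for `k ≥ 1`, Bessel.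
[cite: ReedSimonIV1978, Thm. XIII.1] -/
theorem l2_iterate_le_pow_secondValue {β : ℝ} (hβ : 0 < β) {Ω v : GaugeConfig 3 L SU2 → ℝ} (hΩ : IsPhys Ω) (hΩ1 : l2 Ω Ω = 1)
    (hΩeig : transferApply β Ω = topValue su2Rep L β • Ω) (hv : IsPhys v) (hvΩ : l2 v Ω = 0) {ℓ : ℕ} (hℓ : 1 ≤ ℓ) :
    l2 v ((transferApply β)^[ℓ] v) ≤ secondValue su2Rep L β ^ ℓ * l2 v v := by
  obtain ⟨e, hon, heig, hdom, hsum, hbessel⟩ := SpecSum.exists_spectral_eigenseq (L := L) hβ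
  set lam : ℕ → ℝ := fun k => levelValue su2Rep L β k with hlam
  set a : ℕ → ℝ := fun k => l2 v ((e k : physSubmodule L) : GaugeConfig 3 L SU2 → ℝ) with ha
  have he0 : IsPhys ((e 0 : physSubmodule L) : GaugeConfig 3 L SU2 → ℝ) := (e 0).2
  -- `a 0 = 0`
  have ha0 : a 0 = 0 := by
    refine l2_eigen_top_eq_zero_of_l2_ground_eq_zero he0 (by simpa using hon 0 0) (heig 0) (fun ψ hψ h0 => ?_) hΩ hΩ1 hΩeig hv hvΩ
    exact hdom 1 ψ hψ (fun i hi => by interval_cases i; exact h0)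
  -- the spectral sum for `⟨v, K^ℓ v⟩`
  have hS : HasSum (fun k => lam k ^ ℓ * (a k * a k)) (l2 v ((transferApply β)^[ℓ] v)) := by
    have h := hsum v v hv hv 0 ℓ (by omega)
    simp only [zero_add, Function.iterate_zero, id_eq] at h
    exact h.congr_fun fun k => by simp only [hlam, ha]; ring
  obtain ⟨hsa, hAle⟩ := hbessel v hv
  have hl1 : 0 ≤ secondValue su2Rep L β := (secondValue_su2Rep_pos hβ).le
  -- termwise comparison with `λ₁^ℓ a_k²`
  have hterm : ∀ k, lam k ^ ℓ * (a k * a k) ≤ secondValue su2Rep L β ^ ℓ * a k ^ 2 := by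
    intro k
    rcases Nat.eq_zero_or_pos k with hk | hk
    · subst hk; rw [ha0]; simp
    · have hle : lam k ≤ secondValue su2Rep L β := by
        rw [← levelValue_one]; exact levelValue_le_of_le hβ hk
      have h0 : 0 ≤ lam k := levelValue_su2Rep_nonneg L hβ.le k
      rw [← sq]
      exact mul_le_mul_of_nonneg_right (pow_le_pow_left₀ h0 hle ℓ) (sq_nonneg _)
  have hS2 : HasSum (fun k => secondValue su2Rep L β ^ ℓ * a k ^ 2) (secondValue su2Rep L β ^ ℓ * ∑' k, a k ^ 2) :=
    (hsa.hasSum).mul_left _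
  calc l2 v ((transferApply β)^[ℓ] v) ≤ secondValue su2Rep L β ^ ℓ * ∑' k, a k ^ 2 := hasSum_le hterm hS hS2
    _ ≤ secondValue su2Rep L β ^ ℓ * l2 v v := mul_le_mul_of_nonneg_left hAle (pow_nonneg hl1 ℓ)

/-! ## §3 ★★ The door: vacuum-chain comparison ⟹ the upward step (eventually form) -/

/-- ★★ **`DynComparison ⟹ UpStepEventually`.**  Hypothesis (spelled out): there are `C`, `lam0 > 0` such that for every level `lam ≤ lam0` there is a
threshold `L₀` such that for all `L₀ ≤ L' < L < 2L'`, all window couplings `β` (on `L`), `β'` (on `L'`) with equal running parameter, and EVERY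
physical, `l2`-normalised exact ground state `Ω` of `K_β` on `(ℤ/L)³`, some physical `v ⊥ Ω`, `v ≠ 0`, satisfies
`λ₁(β',L')^{L'}·λ₀(β,L)^L·‖v‖² ≤ e^{CΛ²}·λ₀(β',L')^{L'}·⟨v, K_β^L v⟩` (its physical-time-1 vacuum-chain autocorrelation dominates the coarse ratio).
Conclusion: the upward incommensurable step `λ₁(β',L')^{L'}·λ₀(β,L)^L ≤ e^{CΛ²}·λ₁(β,L)^L·λ₀(β',L')^{L'}` in eventually form (= hypothesis (hU) of
`CutoffLadder.femtoGapOfRecord_of_towerLadder_up`).  Proof: §2 on the fine lattice, and a ground state exists (`PhysL2.exists_groundState_gap`).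
[cite: ReedSimonIV1978, Thm. XIII.1] [cite: LuscherWeiszWolff1991] -/
theorem upStepEventually_of_dynComparison
    (hD : ∃ C lam0 : ℝ, 0 < lam0 ∧ ∀ lam : ℝ, 0 < lam → lam ≤ lam0 → ∃ L0 : ℕ,
      ∀ (L' : ℕ) [NeZero L'] (L : ℕ) [NeZero L], L0 ≤ L' → L' < L → L < 2 * L' →
        ∀ β β' : ℝ, InFemtoWindow lam β L → InFemtoWindow lam β' L' → luscherLambda β L = luscherLambda β' L' →
          ∀ Ω : GaugeConfig 3 L SU2 → ℝ, IsPhys Ω → l2 Ω Ω = 1 → transferApply β Ω = topValue su2Rep L β • Ω →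
            ∃ v : GaugeConfig 3 L SU2 → ℝ, IsPhys v ∧ l2 v Ω = 0 ∧ 0 < l2 v v ∧
              secondValue su2Rep L' β' ^ L' * topValue su2Rep L β ^ L * l2 v v ≤
                Real.exp (C * luscherLambda β L ^ 2) * (topValue su2Rep L' β' ^ L' * l2 v ((transferApply β)^[L] v))) :
    ∃ C lam0 : ℝ, 0 < lam0 ∧ ∀ lam : ℝ, 0 < lam → lam ≤ lam0 → ∃ L0 : ℕ,
      ∀ (L' : ℕ) [NeZero L'] (L : ℕ) [NeZero L], L0 ≤ L' → L' < L → L < 2 * L' →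
        ∀ β β' : ℝ, InFemtoWindow lam β L → InFemtoWindow lam β' L' → luscherLambda β L = luscherLambda β' L' →
          secondValue su2Rep L' β' ^ L' * topValue su2Rep L β ^ L ≤
            Real.exp (C * luscherLambda β L ^ 2) * (secondValue su2Rep L β ^ L * topValue su2Rep L' β' ^ L') := by
  obtain ⟨C, lam0, hlam0, H⟩ := hD
  refine ⟨C, lam0, hlam0, fun lam hlam hle => ?_⟩
  obtain ⟨L0, HL⟩ := H lam hlam hle
  refine ⟨L0, fun L' _ L _ hL0 hlt hlt2 β β' hW hW' hm => ?_⟩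
  have hβ : 0 < β := by linarith [hW.1]
  have hL1 : 1 ≤ L := NeZero.one_le
  obtain ⟨Ω, θ, hΩ, -, hΩ1, hΩeig, -, -, -⟩ := PhysL2.exists_groundState_gap (L := L) β
  obtain ⟨v, hv, hvΩ, hvpos, hcmp⟩ := HL L' L hL0 hlt hlt2 β β' hW hW' hm Ω hΩ hΩ1 hΩeig
  have hvar := l2_iterate_le_pow_secondValue hβ hΩ hΩ1 hΩeig hv hvΩ hL1
  have hb' : 0 ≤ topValue su2Rep L' β' ^ L' := pow_nonneg (topValue_su2Rep_pos L' β').le _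
  have h1 : Real.exp (C * luscherLambda β L ^ 2) * (topValue su2Rep L' β' ^ L' * l2 v ((transferApply β)^[L] v)) ≤
      Real.exp (C * luscherLambda β L ^ 2) * (topValue su2Rep L' β' ^ L' * (secondValue su2Rep L β ^ L * l2 v v)) :=
    mul_le_mul_of_nonneg_left (mul_le_mul_of_nonneg_left hvar hb') (Real.exp_pos _).le
  have h2 := hcmp.trans h1
  have h3 : (secondValue su2Rep L' β' ^ L' * topValue su2Rep L β ^ L) * l2 v v ≤
      (Real.exp (C * luscherLambda β L ^ 2) * (secondValue su2Rep L β ^ L * topValue su2Rep L' β' ^ L')) * l2 v v := by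
    calc (secondValue su2Rep L' β' ^ L' * topValue su2Rep L β ^ L) * l2 v v
        = secondValue su2Rep L' β' ^ L' * topValue su2Rep L β ^ L * l2 v v := by ring
      _ ≤ Real.exp (C * luscherLambda β L ^ 2) * (topValue su2Rep L' β' ^ L' * (secondValue su2Rep L β ^ L * l2 v v)) := h2
      _ = (Real.exp (C * luscherLambda β L ^ 2) * (secondValue su2Rep L β ^ L * topValue su2Rep L' β' ^ L')) * l2 v v := by ring
  exact le_of_mul_le_mul_right h3 hvpos

/-! ## §4 (appended) The door at ONE pair — reusable for any pair set (incommensurable, nested dyadic `L = 2^k·L'`, …) -/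

/-- **The door at a single pair** `(L', β')` coarse, `(L, β)` fine (`β ≥ 1`), slack `s`: if for every physical normalised exact ground state `Ω` of
`K_β` on `(ℤ/L)³` some physical `v ⊥ Ω`, `v ≠ 0`, has `λ₁(β',L')^{L'}·λ₀(β,L)^L·‖v‖² ≤ e^{s}·λ₀(β',L')^{L'}·⟨v,K_β^L v⟩`, then
`λ₁(β',L')^{L'}·λ₀(β,L)^L ≤ e^{s}·λ₁(β,L)^L·λ₀(β',L')^{L'}`.  The quantifier prefix (which pairs, threshold before or after the level) is left to
the caller: this serves the incommensurable upward step (§3) and the nested dyadic upper step (`Theses.FemtoCutoffLadder.DyadicNestedUpper`,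
stmt-QuantumFields-25766) alike. [cite: ReedSimonIV1978, Thm. XIII.1] -/
theorem upStepAt_of_dynComparisonAt {L L' : ℕ} [NeZero L] [NeZero L'] {β β' s : ℝ} (hβ : 1 ≤ β)
    (hD : ∀ Ω : GaugeConfig 3 L SU2 → ℝ, IsPhys Ω → l2 Ω Ω = 1 → transferApply β Ω = topValue su2Rep L β • Ω →
      ∃ v : GaugeConfig 3 L SU2 → ℝ, IsPhys v ∧ l2 v Ω = 0 ∧ 0 < l2 v v ∧
        secondValue su2Rep L' β' ^ L' * topValue su2Rep L β ^ L * l2 v v ≤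
          Real.exp s * (topValue su2Rep L' β' ^ L' * l2 v ((transferApply β)^[L] v))) :
    secondValue su2Rep L' β' ^ L' * topValue su2Rep L β ^ L ≤
      Real.exp s * (secondValue su2Rep L β ^ L * topValue su2Rep L' β' ^ L') := by
  have hβ0 : 0 < β := by linarith
  have hL1 : 1 ≤ L := NeZero.one_le
  obtain ⟨Ω, θ, hΩ, -, hΩ1, hΩeig, -, -, -⟩ := PhysL2.exists_groundState_gap (L := L) β
  obtain ⟨v, hv, hvΩ, hvpos, hcmp⟩ := hD Ω hΩ hΩ1 hΩeig
  have hvar := l2_iterate_le_pow_secondValue hβ0 hΩ hΩ1 hΩeig hv hvΩ hL1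
  have hb' : 0 ≤ topValue su2Rep L' β' ^ L' := pow_nonneg (topValue_su2Rep_pos L' β').le _
  have h1 : Real.exp s * (topValue su2Rep L' β' ^ L' * l2 v ((transferApply β)^[L] v)) ≤
      Real.exp s * (topValue su2Rep L' β' ^ L' * (secondValue su2Rep L β ^ L * l2 v v)) :=
    mul_le_mul_of_nonneg_left (mul_le_mul_of_nonneg_left hvar hb') (Real.exp_pos _).le
  have h2 := hcmp.trans h1
  have h3 : (secondValue su2Rep L' β' ^ L' * topValue su2Rep L β ^ L) * l2 v v ≤
      (Real.exp s * (secondValue su2Rep L β ^ L * topValue su2Rep L' β' ^ L')) * l2 v v := by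
    calc (secondValue su2Rep L' β' ^ L' * topValue su2Rep L β ^ L) * l2 v v
        = secondValue su2Rep L' β' ^ L' * topValue su2Rep L β ^ L * l2 v v := by ring
      _ ≤ Real.exp s * (topValue su2Rep L' β' ^ L' * (secondValue su2Rep L β ^ L * l2 v v)) := h2
      _ = (Real.exp s * (secondValue su2Rep L β ^ L * topValue su2Rep L' β' ^ L')) * l2 v v := by ring
  exact le_of_mul_le_mul_right h3 hvpos

end Summit.QuantumFields.YangMills.Theorems.FemtoTransferGap.UpStep

end
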